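import Summits.BirchSwinnertonDyer.BirchSwinnertonDyer.Theorems.EisensteinDepletionAtTwoStarKummerDoorD
import Summits.BirchSwinnertonDyer.BirchSwinnertonDyer.Theorems.EisensteinDepletionAtTwoStarOptBNSFNsfDoorPrint
import Literature.NumberTheory.EllipticCurves.CuspFormLFunctionLevelConductorProofs
import Literature.NumberTheory.EllipticCurves.ManinConstantDeuringTwistProofs
import HarnessLib

/-!
# E1M_NSF (stmt-BirchSwinnertonDyer-27021) FROM FOUR PUBLISHED THEOREMS — the joint door of lines `kummer` (27046) and `nsf` (27047)
# (lead bsd-rank2-star-p1 GEN 13, 2026-08-28)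

The split parent `DepletedLambdaLawAtTwoModNSF` (27021) `= StarGO2Sigma (27046) ∧ StarOptBNSF (27047)` (glue 27048) is, after this
GEN, KERNEL GLUE + NAMED PUBLISHED FACTS ONLY: every research stub of both lines is a tree theorem (kummer: 1a, 2, 3, KA, K-Θ, K-A, K-U,
and the print K-D PROVED — `dedekindEta_logTransformationLaw_holds`, p676904; nsf: GEN 8–12).  This file composes the two doors:
* `stub_levelEqConductor_of_modularity` — Carayol's level theorem in the tree's shape follows from MODULARITY `exists_isNewformOf`
  (tree: `IsNewformOf.level_eq_conductorNorm_of_exists_isNewformOf'`, strong multiplicity one across levels), so kummer's print list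
  is {modularity, Edixhoven ∧ Abbes–Ullmo, Calegari–Dimitrov–Tang};
* `starGO2Sigma_of_published` — 27046 from those three;
* `depletedLambdaLawAtTwoModNSF_of_published` — **27021 from FOUR named published theorems**: modularity (`exists_isNewformOf`,
  BCDT 2001), the optimal `Γ₁`-datum (`exists_optimal_gamma1ParametrizationData`, Stevens 1989 / Česnavičius), the Manin-constant facts
  (`edixhoven_optimalManinConstant_integral ∧ abbesUllmo_not_dvd_maninConstant_of_not_dvd_level`) and unbounded denominators
  (`CalegariDimitrovTang2025_unboundedDenominators`), via kummer's Carayol-free parent composition and nsf's `starOptBNSF_of_print`.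

HONEST FRAMING (Barrier B1): CONDITIONAL RESULTS on named facts the tree does not prove; the items 27021/27046/27047 are NOT closed by
this file; nothing here reads an analytic rank; E1M and BSD are NOT proved (PARTITION D-0054: none — r_an ≥ 2, axis S0).
-/

set_option linter.dupNamespace false
set_option autoImplicit false

namespace Summit.BirchSwinnertonDyer.BirchSwinnertonDyer.Theorems.DepletionAtTwo.KummerDoor

open Literature.NumberTheory.EllipticCurves Literature.NumberTheory.EllipticCurves.ModularForms

/-- Carayol's level theorem in the tree's shape (`stub_levelEqConductor` of line `kummer`) from MODULARITY `exists_isNewformOf`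
(strong multiplicity one across levels, tree). [cite: DiamondShurman2005, Thm. 8.8.1] [cite: AtkinLehner1970, Thm. 4] -/
theorem stub_levelEqConductor_of_modularity (hnf : exists_isNewformOf) : stub_levelEqConductor :=
  fun _ _ ↦ IsNewformOf.level_eq_conductorNorm_of_exists_isNewformOf' hnf

/-- **`StarGO2Sigma` (27046) from THREE named published theorems**: modularity, Edixhoven ∧ Abbes–Ullmo, Calegari–Dimitrov–Tang.
CONDITIONAL RESULT. [cite: Stevens1982, §2.5] [cite: BCDTJAMS2001, Thm. A] -/
theorem starGO2Sigma_of_published (hnf : exists_isNewformOf) (hMP : stub_maninPrint)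
    (hU : Literature.NumberTheory.Automorphic.CalegariDimitrovTang2025_unboundedDenominators) :
    Summit.BirchSwinnertonDyer.BirchSwinnertonDyer.Theses.EisensteinDepletionAtTwo.StarGO2Sigma :=
  starGO2Sigma_of_three_prints (stub_levelEqConductor_of_modularity hnf) hMP hU

/-- **E1M_NSF `DepletedLambdaLawAtTwoModNSF` (27021) from FOUR named published theorems** — modularity (`exists_isNewformOf`), the
optimal `Γ₁`-parametrization datum (`exists_optimal_gamma1ParametrizationData`), Edixhoven ∧ Abbes–Ullmo (`stub_maninPrint`) and
Calegari–Dimitrov–Tang unbounded denominators — composing line `kummer`'s Carayol-free parent door (`depletedLambdaLawAtTwoModNSF_of_two_prints`,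
K-D proved) with line `nsf`'s `NsfDoorPrint.starOptBNSF_of_print`.  CONDITIONAL RESULT; the item is NOT closed by this theorem.
[cite: GreenbergVatsal2000, §3 Thm. (3.12)] [cite: CalegariDimitrovTang2025, Thm. 1.0.1] [cite: BCDTJAMS2001, Thm. A] -/
theorem depletedLambdaLawAtTwoModNSF_of_published (hnf : exists_isNewformOf) (hex : exists_optimal_gamma1ParametrizationData)
    (hMP : stub_maninPrint) (hU : Literature.NumberTheory.Automorphic.CalegariDimitrovTang2025_unboundedDenominators) :
    Summit.BirchSwinnertonDyer.BirchSwinnertonDyer.Theses.EisensteinDepletionAtTwo.DepletedLambdaLawAtTwoModNSF :=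
  depletedLambdaLawAtTwoModNSF_of_two_prints hMP hU (NsfDoorPrint.starOptBNSF_of_print hnf hex hU)

/-! ### Appendix (same GEN): Edixhoven's integrality is a TREE THEOREM, so the Manin print is Abbes–Ullmo alone -/

/-- The Manin print handle of line `kummer` from Abbes–Ullmo ALONE: Edixhoven's integrality of the optimal Manin constant is PROVED in
the tree (`ModularForms.edixhoven_optimalManinConstant_integral_holds`, `ManinConstantDeuringTwistProofs`). [cite: EdixhovenManin1991, Prop. 2]
[cite: AbbesUllmo1996, Thm. A] -/
theorem stub_maninPrint_of_abbesUllmo (hAU : abbesUllmo_not_dvd_maninConstant_of_not_dvd_level) : stub_maninPrint :=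
  ⟨ModularForms.edixhoven_optimalManinConstant_integral_holds, hAU⟩

/-- **`StarGO2Sigma` (27046) from THREE named published theorems, sharpened**: modularity (`exists_isNewformOf`), Abbes–Ullmo Thm. A
(`abbesUllmo_not_dvd_maninConstant_of_not_dvd_level`), Calegari–Dimitrov–Tang.  CONDITIONAL RESULT. [cite: Stevens1982, §2.5]
[cite: AbbesUllmo1996, Thm. A] -/
theorem starGO2Sigma_of_modularity_abbesUllmo_ubd (hnf : exists_isNewformOf)
    (hAU : abbesUllmo_not_dvd_maninConstant_of_not_dvd_level)
    (hU : Literature.NumberTheory.Automorphic.CalegariDimitrovTang2025_unboundedDenominators) :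
    Summit.BirchSwinnertonDyer.BirchSwinnertonDyer.Theses.EisensteinDepletionAtTwo.StarGO2Sigma :=
  starGO2Sigma_of_published hnf (stub_maninPrint_of_abbesUllmo hAU) hU

/-- **E1M_NSF `DepletedLambdaLawAtTwoModNSF` (27021) from FOUR named published theorems, sharpened** — modularity
(`exists_isNewformOf`, BCDT), the optimal `Γ₁`-datum (`exists_optimal_gamma1ParametrizationData`), Abbes–Ullmo Thm. A
(`abbesUllmo_not_dvd_maninConstant_of_not_dvd_level`) and Calegari–Dimitrov–Tang unbounded denominators.  CONDITIONAL RESULT; the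
item is NOT closed by this theorem; BSD is not proved here. [cite: GreenbergVatsal2000, §3 Thm. (3.12)] [cite: AbbesUllmo1996, Thm. A]
[cite: CalegariDimitrovTang2025, Thm. 1.0.1] [cite: BCDTJAMS2001, Thm. A] -/
theorem depletedLambdaLawAtTwoModNSF_of_modularity_gamma1_abbesUllmo_ubd (hnf : exists_isNewformOf)
    (hex : exists_optimal_gamma1ParametrizationData) (hAU : abbesUllmo_not_dvd_maninConstant_of_not_dvd_level)
    (hU : Literature.NumberTheory.Automorphic.CalegariDimitrovTang2025_unboundedDenominators) :
    Summit.BirchSwinnertonDyer.BirchSwinnertonDyer.Theses.EisensteinDepletionAtTwo.DepletedLambdaLawAtTwoModNSF :=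
  depletedLambdaLawAtTwoModNSF_of_published hnf hex (stub_maninPrint_of_abbesUllmo hAU) hU

end Summit.BirchSwinnertonDyer.BirchSwinnertonDyer.Theorems.DepletionAtTwo.KummerDoor
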